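import Mathlib
import Literature.Analysis.PDE.Wave1DExteriorEnergy
import Literature.Analysis.PDE.Wave1DFluxBookkeeping
import HarnessLib

/-!
# Outgoing half-line energy for `ψ_tt − ψ_xx + V(x)ψ = F` with a source supported to the left

Analysis/PDE support file (everything proved). If the (continuous) source `F` vanishes on the
half-space `{x ≥ c + s}` then the energy to the right of the outgoing point `c + t` at time `t ≥ s`
is at most the energy to the right of `c + s` at time `s`
(`wave1D_lintegral_Ioi_energy_mono_of_source`; lower Lebesgue integrals, `∞` allowed), and the
time-reversed statement (`…_backward`), via `wave1D_timeReversal_source`. These are the sourced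
versions of `Wave1DExteriorEnergy.lean` needed for functions that solve the homogeneous equation only
on a half-space — e.g. the explicit inverse-square waves `ladder ι n Φ(t,·)` (exact on `x > ½`) of
the far-side channel estimate of route PhotonSphereChannels (`FixedModeChannels`,
stmt-FinalStateConjecture-10048). Folklore (domain of dependence).
-/

noncomputable section

namespace Literature.Analysis.PDE

open MeasureTheory Set Filter Topology intervalIntegral

variable {V : ℝ → ℝ} {F ψ : ℝ → ℝ → ℝ}

/-- **Outgoing half-line energy is non-increasing when the source lives to the left.** [folklore] -/
theorem wave1D_lintegral_Ioi_energy_mono_of_source (hV : Continuous V) (hV0 : ∀ x, 0 ≤ V x)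
    (hF : Continuous (Function.uncurry F)) (hψ : ContDiff ℝ 2 (Function.uncurry ψ))
    (hsol : ∀ t x, iteratedDeriv 2 (fun τ => ψ τ x) t - iteratedDeriv 2 (ψ t) x + V x * ψ t x
      = F t x)
    {c s t : ℝ} (hst : s ≤ t) (hF0 : ∀ τ x, c + s ≤ x → F τ x = 0) :
    ∫⁻ x in Ioi (c + t), ENNReal.ofReal
        (deriv (fun τ => ψ τ x) t ^ 2 + deriv (ψ t) x ^ 2 + V x * ψ t x ^ 2)
      ≤ ∫⁻ x in Ioi (c + s), ENNReal.ofReal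
        (deriv (fun τ => ψ τ x) s ^ 2 + deriv (ψ s) x ^ 2 + V x * ψ s x ^ 2) := by
  have hunion : Ioi (c + t) = ⋃ n : ℕ, Ioc (c + t) (c + t + n) := by
    ext x
    simp only [mem_iUnion, mem_Ioc, mem_Ioi]
    constructor
    · intro h
      obtain ⟨n, hn⟩ := exists_nat_gt (x - (c + t))
      exact ⟨n, h, by linarith⟩
    · rintro ⟨n, h1, _⟩
      exact h1
  have hdir : Directed (· ⊆ ·) fun n : ℕ => Ioc (c + t) (c + t + n) :=
    Monotone.directed_le fun m n hmn => Ioc_subset_Ioc le_rfl (by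
      have : (m : ℝ) ≤ n := by exact_mod_cast hmn
      linarith)
  rw [hunion, setLIntegral_iUnion_of_directed _ hdir]
  refine iSup_le fun n => ?_
  have hn0 : (0 : ℝ) ≤ n := n.cast_nonneg
  have hmono := wave1D_trapezoid_energy_mono_of_source_eq_zero hV hV0 hF hψ hsol (a := c)
    (b := c + 2 * t + n) hst (by linarith) (fun τ hτ x hx => hF0 τ x (by linarith [hx.1, hτ.1]))
  have htop : c + 2 * t + n - t = c + t + n := by ring
  rw [htop] at hmono
  rw [lintegral_Ioc_wave1D_energy_eq hV hV0 hψ t (by linarith)]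
  calc ENNReal.ofReal (∫ x in (c + t)..(c + t + n),
          (deriv (fun τ => ψ τ x) t ^ 2 + deriv (ψ t) x ^ 2 + V x * ψ t x ^ 2))
      ≤ ENNReal.ofReal (∫ x in (c + s)..(c + 2 * t + n - s),
          (deriv (fun τ => ψ τ x) s ^ 2 + deriv (ψ s) x ^ 2 + V x * ψ s x ^ 2)) :=
        ENNReal.ofReal_le_ofReal hmono
    _ = ∫⁻ x in Ioc (c + s) (c + 2 * t + n - s), ENNReal.ofReal
          (deriv (fun τ => ψ τ x) s ^ 2 + deriv (ψ s) x ^ 2 + V x * ψ s x ^ 2) :=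
        (lintegral_Ioc_wave1D_energy_eq hV hV0 hψ s (by linarith)).symm
    _ ≤ _ := lintegral_mono_set Ioc_subset_Ioi_self

/-- **Time reversal with a source**: `(t,x) ↦ ψ(−t,x)` solves the equation with source
`(t,x) ↦ F(−t,x)`, is `C²`, and has energy density `e(−t,x)`. [folklore] -/
theorem wave1D_timeReversal_source (hψ : ContDiff ℝ 2 (Function.uncurry ψ))
    (hsol : ∀ t x, iteratedDeriv 2 (fun τ => ψ τ x) t - iteratedDeriv 2 (ψ t) x + V x * ψ t x
      = F t x) :
    ContDiff ℝ 2 (Function.uncurry fun t x => ψ (-t) x) ∧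
    (∀ t x, iteratedDeriv 2 (fun τ => (fun t x => ψ (-t) x) τ x) t
        - iteratedDeriv 2 ((fun t x => ψ (-t) x) t) x + V x * (fun t x => ψ (-t) x) t x
        = F (-t) x) ∧
    (∀ t x, deriv (fun τ => (fun t x => ψ (-t) x) τ x) t ^ 2
        = deriv (fun τ => ψ τ x) (-t) ^ 2) := by
  refine ⟨?_, fun t x => ?_, fun t x => ?_⟩
  · have : (Function.uncurry fun t x => ψ (-t) x)
        = Function.uncurry ψ ∘ fun p : ℝ × ℝ => (-p.1, p.2) := by
      funext p; rfl
    rw [this]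
    exact hψ.comp (contDiff_neg.prodMap contDiff_id)
  · have h := hsol (-t) x
    have h2 : iteratedDeriv 2 (fun τ => ψ (-τ) x) t = iteratedDeriv 2 (fun τ => ψ τ x) (-t) := by
      rw [iteratedDeriv_comp_neg 2 (fun τ => ψ τ x) t]
      norm_num
    simpa [h2] using h
  · simp only [deriv_comp_neg (fun τ => ψ τ x) t, even_two.neg_pow]

/-- **Backward version**: if the source vanishes on `{x ≥ c − s}` and `t ≤ s`, then
`∫⁻_{x > c − t} e(t,·) ≤ ∫⁻_{x > c − s} e(s,·)`. [folklore] -/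
theorem wave1D_lintegral_Ioi_energy_mono_of_source_backward (hV : Continuous V)
    (hV0 : ∀ x, 0 ≤ V x) (hF : Continuous (Function.uncurry F))
    (hψ : ContDiff ℝ 2 (Function.uncurry ψ))
    (hsol : ∀ t x, iteratedDeriv 2 (fun τ => ψ τ x) t - iteratedDeriv 2 (ψ t) x + V x * ψ t x
      = F t x)
    {c s t : ℝ} (hts : t ≤ s) (hF0 : ∀ τ x, c - s ≤ x → F τ x = 0) :
    ∫⁻ x in Ioi (c - t), ENNReal.ofReal
        (deriv (fun τ => ψ τ x) t ^ 2 + deriv (ψ t) x ^ 2 + V x * ψ t x ^ 2)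
      ≤ ∫⁻ x in Ioi (c - s), ENNReal.ofReal
        (deriv (fun τ => ψ τ x) s ^ 2 + deriv (ψ s) x ^ 2 + V x * ψ s x ^ 2) := by
  obtain ⟨hψ', hsol', he'⟩ := wave1D_timeReversal_source hψ hsol
  have hF' : Continuous (Function.uncurry fun t x => F (-t) x) := by
    have : (Function.uncurry fun t x => F (-t) x)
        = Function.uncurry F ∘ fun p : ℝ × ℝ => (-p.1, p.2) := by
      funext p; rfl
    rw [this]; exact hF.comp (continuous_neg.prodMap continuous_id)
  have h := wave1D_lintegral_Ioi_energy_mono_of_source hV hV0 hF' hψ' hsol' (c := c) (s := -s)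
    (t := -t) (by linarith) (fun τ x hx => hF0 (-τ) x (by linarith))
  simp only [he', neg_neg] at h
  simpa [sub_eq_add_neg] using h

end Literature.Analysis.PDE
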